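import Summits.RiemannHypothesis.RiemannHypothesis.Theorems.UniversalFactorNarrowKernelNoGoEnergyLowerPhase
import Summits.RiemannHypothesis.RiemannHypothesis.Theorems.UniversalFactorNarrowKernelNoGoEnergyLowerKernel
import Literature.NumberTheory.LFunctions.ZetaMeanSquareLowerBound
import Literature.NumberTheory.LFunctions.SaiasWeingartnerTools

/-!
# RiemannHypothesis / UniversalFactor — `NarrowKernelNoGo`, line `Sketch`, stub K1a (energy lower
bound): the three terms of the shifted Hardy function against a test Dirichlet polynomial

Route `RiemannHypothesis/UniversalFactor`, crux `NarrowKernelNoGo` (stmt-RiemannHypothesis-2576), stub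
`UniversalFactor.stub_narrowEnergyLowerClean` (lead). On a block `B = [T', T' + U]`, for a shift `u` and a
test polynomial `D(t) = Σ_{n ≤ P} a_n n^{it}`, Hardy's first approximation
`Z(t+u) = E₁(t+u) S_P(t+u) + conj(…) + e_P(t+u)` (`TwistedMoment.hardyZErr`) splits
`∫_B Z(t+u) conj(E₁(t)) D(t) dt` into three terms. This file bounds them generically:

* `UniversalFactor.narrowTermA_frozen_le` — the "diagonal" term with the phase frozen:
  `‖∫_B D(t) S_P(t+u) dt − U Σ a_n n^{-1/2} e^{−iu log n}‖ ≤ 3712 (P + Σ n‖a_n‖²)` (bilinear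
  Montgomery–Vaughan, tree `norm_integral_dirichletPoly_mul_conj_sub_le`);
* `UniversalFactor.narrowTermA_phase_le` — the phase-defect part, by `‖xy‖ ≤ (‖x‖² + ‖y‖²)/2`;
* `UniversalFactor.narrowTermB_le` — the NON-STATIONARY cross term
  `‖∫_B conj(E₁(t+u)E₁(t)) conj(S_P(t+u)) D(t) dt‖ ≤ (2/log 2)(Σ_{μ≤P} μ^{-1/2})(Σ‖a_n‖)` when
  `2πP² ≤ T' + u` and `a_n = 0` unless `8πn² ≤ T'` (van der Corput, `UniversalFactor.narrowTermB_vdC`);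
* `UniversalFactor.narrow_norm_integral_mul_le_amgm` — the Cauchy/AM–GM bound used for the error term;
* `UniversalFactor.norm_hardyZ_le_linear`, `UniversalFactor.abs_narrowKer_mul_hardyZ_le` — crude sizes.

References: Titchmarsh (1986) §7.3–7.4; Montgomery–Vaughan 1974; Ivić 1985 Thm 5.2.
-/

noncomputable section

-- D-0017: `Summit.<S>.<S>.…` is the designed namespace of a single-problem summit.
set_option linter.dupNamespace false

namespace Summit.RiemannHypothesis.RiemannHypothesis.Theorems

open MeasureTheory Set Filter Complex intervalIntegral
open scoped Real Topology ComplexConjugate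
open Literature.NumberTheory.LFunctions Literature.NumberTheory.LFunctions.TwistedMoment

/-! ## Crude size of Hardy's function and of the smoothing integrand -/

/-- `|Z(τ)| ≤ 2 + 2|τ|` (Titchmarsh (2.12.2) via `|Z| = |ζ(1/2+iτ)|`). [cite: Titchmarsh1986, §2.12] -/
theorem UniversalFactor.norm_hardyZ_le_linear (τ : ℝ) : ‖(hardyZ τ : ℂ)‖ ≤ 2 + 2 * |τ| := by
  rw [Complex.norm_real, Real.norm_eq_abs, abs_hardyZ_eq_norm_riemannZeta_holds τ]
  exact ZetaMeanSquare.norm_riemannZeta_line_le τ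

/-- The smoothing integrand `κ_a(u) Z(t+u)` is dominated by `(2 + 2|t|)κ_a(u) + 2|u| κ_a(u)`, hence by
`(2 + 2R)(1 + |u|) κ_a(u)` for `|t| ≤ R`. [folklore] -/
theorem UniversalFactor.abs_narrowKer_mul_hardyZ_le {a t u R : ℝ} (ht : |t| ≤ R) :
    |Real.exp (-(2 * a * |u|)) * Real.exp (-(π * u / 4)) * hardyZ (t + u)| ≤
      (2 + 2 * R) * ((1 + |u|) * (Real.exp (-(2 * a * |u|)) * Real.exp (-(π * u / 4)))) := by
  have hκ := UniversalFactor.narrowKer_pos a u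
  rw [abs_mul, abs_of_pos hκ]
  have hZ : |hardyZ (t + u)| ≤ 2 + 2 * |t + u| := by
    have := UniversalFactor.norm_hardyZ_le_linear (t + u)
    rwa [Complex.norm_real, Real.norm_eq_abs] at this
  have htu : |t + u| ≤ R + |u| := (abs_add_le t u).trans (by linarith)
  have hR : 0 ≤ R := (abs_nonneg t).trans ht
  set κ := Real.exp (-(2 * a * |u|)) * Real.exp (-(π * u / 4)) with hκdef
  calc κ * |hardyZ (t + u)|
      ≤ κ * (2 + 2 * (R + |u|)) := mul_le_mul_of_nonneg_left (hZ.trans (by linarith)) hκ.le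
    _ ≤ (2 + 2 * R) * ((1 + |u|) * κ) := by
        have h : (2 + 2 * R) * ((1 + |u|) * κ) - κ * (2 + 2 * (R + |u|)) = 2 * R * |u| * κ := by ring
        have h' : 0 ≤ 2 * R * |u| * κ := by positivity
        linarith

/-! ## Elementary: products and AM–GM -/

/-- `‖x y‖ ≤ (η‖x‖² + ‖y‖²/η)/2` for `η > 0`. [folklore] -/
theorem UniversalFactor.narrow_norm_mul_le_amgm {η : ℝ} (hη : 0 < η) (x y : ℂ) :
    ‖x * y‖ ≤ (η * ‖x‖ ^ 2 + ‖y‖ ^ 2 / η) / 2 := by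
  rw [norm_mul]
  have h : 0 ≤ (η * ‖x‖ - ‖y‖) ^ 2 / η := by positivity
  have h2 : (η * ‖x‖ - ‖y‖) ^ 2 / η = η * ‖x‖ ^ 2 - 2 * (‖x‖ * ‖y‖) + ‖y‖ ^ 2 / η := by
    field_simp
    ring
  linarith

/-- **Cauchy/AM–GM for a block integral**: for `f, g` continuous on `[T₁, T₂]` (`T₁ ≤ T₂`) and `η > 0`,
`‖∫ f g‖ ≤ (η ∫‖f‖² + (∫‖g‖²)/η)/2`. [folklore] -/
theorem UniversalFactor.narrow_norm_integral_mul_le_amgm {f g : ℝ → ℂ} {T₁ T₂ η : ℝ} (h12 : T₁ ≤ T₂)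
    (hη : 0 < η) (hf : ContinuousOn f (Icc T₁ T₂)) (hg : ContinuousOn g (Icc T₁ T₂)) :
    ‖∫ t in T₁..T₂, f t * g t‖ ≤
      (η * (∫ t in T₁..T₂, ‖f t‖ ^ 2) + (∫ t in T₁..T₂, ‖g t‖ ^ 2) / η) / 2 := by
  have hfi : IntervalIntegrable (fun t => ‖f t‖ ^ 2) volume T₁ T₂ :=
    ((hf.norm.pow 2).mono (by rw [uIcc_of_le h12])).intervalIntegrable
  have hgi : IntervalIntegrable (fun t => ‖g t‖ ^ 2) volume T₁ T₂ :=
    ((hg.norm.pow 2).mono (by rw [uIcc_of_le h12])).intervalIntegrable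
  calc ‖∫ t in T₁..T₂, f t * g t‖ ≤ ∫ t in T₁..T₂, ‖f t * g t‖ :=
        intervalIntegral.norm_integral_le_integral_norm h12
    _ ≤ ∫ t in T₁..T₂, (η * ‖f t‖ ^ 2 + ‖g t‖ ^ 2 / η) / 2 := by
        refine intervalIntegral.integral_mono_on h12 ?_ ?_ fun t _ =>
          UniversalFactor.narrow_norm_mul_le_amgm hη (f t) (g t)
        · exact (((hf.mul hg).norm).mono (by rw [uIcc_of_le h12])).intervalIntegrable
        · exact (((hfi.const_mul η).add (hgi.div_const η)).div_const 2)
    _ = (η * (∫ t in T₁..T₂, ‖f t‖ ^ 2) + (∫ t in T₁..T₂, ‖g t‖ ^ 2) / η) / 2 := by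
        rw [intervalIntegral.integral_div, intervalIntegral.integral_add (hfi.const_mul η) (hgi.div_const η),
          intervalIntegral.integral_const_mul, intervalIntegral.integral_div]

/-! ## The shifted main sum as a Dirichlet polynomial in the `n^{it}` convention -/

/-- `S_P(t + u) = conj(Σ_{n ≤ P} n^{-1/2} e^{iu log n} · n^{it})`. [folklore] -/
theorem UniversalFactor.mainSum_shift_eq_conj (P : ℕ) (t u : ℝ) :
    mainSum P (t + u) = conj (∑ n ∈ Finset.Icc 1 P,
      ((((n : ℝ) ^ (-(1 / 2 : ℝ)) : ℝ) : ℂ) * cexp (I * u * Real.log n)) * (n : ℂ) ^ ((t : ℂ) * I)) := by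
  have h : conj (mainSum P (t + u)) = ∑ n ∈ Finset.Icc 1 P,
      ((((n : ℝ) ^ (-(1 / 2 : ℝ)) : ℝ) : ℂ) * cexp (I * u * Real.log n)) * (n : ℂ) ^ ((t : ℂ) * I) := by
    rw [conj_mainSum]
    refine Finset.sum_congr rfl fun n hn => ?_
    have hn : 0 < n := (Finset.mem_Icc.1 hn).1
    rw [natCast_cpow_mul_I_eq_cexp hn]
    simp only [mul_assoc, ← Complex.exp_add]
    congr 2
    push_cast
    ring
  rw [← h, conj_conj]

/-- The coefficients `b_n = n^{-1/2} e^{iu log n}` have `‖b_n‖² = n⁻¹` (`n ≥ 1`). [folklore] -/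
theorem UniversalFactor.norm_sq_shiftCoeff {n : ℕ} (hn : 1 ≤ n) (u : ℝ) :
    ‖(((n : ℝ) ^ (-(1 / 2 : ℝ)) : ℝ) : ℂ) * cexp (I * u * Real.log n)‖ ^ 2 = ((n : ℝ))⁻¹ := by
  have hn0 : (0 : ℝ) < n := by exact_mod_cast hn
  rw [norm_mul, show I * (u : ℂ) * (Real.log n : ℂ) = ((u * Real.log n : ℝ) : ℂ) * I by push_cast; ring,
    Complex.norm_exp_ofReal_mul_I, mul_one, Complex.norm_real, Real.norm_eq_abs,
    abs_of_nonneg (Real.rpow_nonneg hn0.le _), ← Real.rpow_natCast, ← Real.rpow_mul hn0.le]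
  norm_num
  rw [Real.rpow_neg_one]

/-! ## Term A -/

/-- **Term A, frozen phase** (bilinear Montgomery–Vaughan): for any coefficients `a_n`,
`‖∫_{T₁}^{T₂} (Σ a_n n^{it}) S_P(t+u) dt − (T₂ − T₁) Σ a_n n^{-1/2} e^{−iu log n}‖ ≤ 3712 (P + Σ n ‖a_n‖²)`.
[cite: MontgomeryVaughan1974, Corollary 3] -/
theorem UniversalFactor.narrowTermA_frozen_le (P : ℕ) (a : ℕ → ℂ) (u T₁ T₂ : ℝ) :
    ‖(∫ t in T₁..T₂, (∑ n ∈ Finset.Icc 1 P, a n * (n : ℂ) ^ ((t : ℂ) * I)) * mainSum P (t + u)) -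
        (T₂ - T₁) * ∑ n ∈ Finset.Icc 1 P,
          a n * ((((n : ℝ) ^ (-(1 / 2 : ℝ)) : ℝ) : ℂ) * cexp (-(I * u * Real.log n)))‖ ≤
      3712 * ((P : ℝ) + ∑ n ∈ Finset.Icc 1 P, (n : ℝ) * ‖a n‖ ^ 2) := by
  set b : ℕ → ℂ := fun n => (((n : ℝ) ^ (-(1 / 2 : ℝ)) : ℝ) : ℂ) * cexp (I * u * Real.log n) with hb
  have hmain : ∀ t : ℝ, (∑ n ∈ Finset.Icc 1 P, a n * (n : ℂ) ^ ((t : ℂ) * I)) * mainSum P (t + u) =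
      (∑ n ∈ Finset.Icc 1 P, a n * (n : ℂ) ^ ((t : ℂ) * I)) *
        conj (∑ n ∈ Finset.Icc 1 P, b n * (n : ℂ) ^ ((t : ℂ) * I)) := by
    intro t; rw [UniversalFactor.mainSum_shift_eq_conj]
  have hdiag : ∑ n ∈ Finset.Icc 1 P, a n * ((((n : ℝ) ^ (-(1 / 2 : ℝ)) : ℝ) : ℂ) * cexp (-(I * u * Real.log n))) =
      ∑ n ∈ Finset.Icc 1 P, a n * conj (b n) := by
    refine Finset.sum_congr rfl fun n _ => ?_
    simp only [hb, map_mul, Complex.conj_ofReal, ← Complex.exp_conj, Complex.conj_I, neg_mul]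
  simp_rw [hmain]
  rw [hdiag]
  refine (norm_integral_dirichletPoly_mul_conj_sub_le P a b T₁ T₂).trans ?_
  have hsum : ∑ n ∈ Finset.Icc 1 P, (n : ℝ) * (‖a n‖ ^ 2 + ‖b n‖ ^ 2) =
      ∑ n ∈ Finset.Icc 1 P, (n : ℝ) * ‖a n‖ ^ 2 + ∑ n ∈ Finset.Icc 1 P, (1 : ℝ) := by
    rw [← Finset.sum_add_distrib]
    refine Finset.sum_congr rfl fun n hn => ?_
    have hn1 : 1 ≤ n := (Finset.mem_Icc.1 hn).1
    have hn0 : (n : ℝ) ≠ 0 := by exact_mod_cast (by omega : n ≠ 0)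
    rw [hb, UniversalFactor.norm_sq_shiftCoeff hn1 u, mul_add, mul_inv_cancel₀ hn0]
  rw [hsum, Finset.sum_const, Nat.card_Icc, nsmul_eq_mul, mul_one, Nat.add_sub_cancel]
  linarith

/-- **Term A, phase defect**: if `‖θ(t)‖ ≤ δ` on `[T₁, T₂]` (`θ` continuous there), then
`‖∫ θ(t) (D(t) S_P(t+u)) dt‖ ≤ δ (∫‖D‖² + ∫‖S_P(·+u)‖²)/2`. [folklore] -/
theorem UniversalFactor.narrowTermA_phase_le (P : ℕ) (a : ℕ → ℂ) {θ : ℝ → ℂ} {u T₁ T₂ δ : ℝ} (h12 : T₁ ≤ T₂)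
    (hδ : 0 ≤ δ) (hθc : ContinuousOn θ (Icc T₁ T₂)) (hθ : ∀ t ∈ Icc T₁ T₂, ‖θ t‖ ≤ δ) :
    ‖∫ t in T₁..T₂, θ t * ((∑ n ∈ Finset.Icc 1 P, a n * (n : ℂ) ^ ((t : ℂ) * I)) * mainSum P (t + u))‖ ≤
      δ * ((∫ t in T₁..T₂, ‖∑ n ∈ Finset.Icc 1 P, a n * (n : ℂ) ^ ((t : ℂ) * I)‖ ^ 2) +
        ∫ t in T₁..T₂, ‖mainSum P (t + u)‖ ^ 2) / 2 := by
  set D : ℝ → ℂ := fun t => ∑ n ∈ Finset.Icc 1 P, a n * (n : ℂ) ^ ((t : ℂ) * I) with hD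
  have hDc : Continuous D := continuous_dirichletPoly P a
  have hSc : Continuous fun t : ℝ => mainSum P (t + u) := (continuous_mainSum P).comp (continuous_id.add continuous_const)
  have hDi : IntervalIntegrable (fun t => ‖D t‖ ^ 2) volume T₁ T₂ := (hDc.norm.pow 2).intervalIntegrable _ _
  have hSi : IntervalIntegrable (fun t => ‖mainSum P (t + u)‖ ^ 2) volume T₁ T₂ :=
    (hSc.norm.pow 2).intervalIntegrable _ _
  calc ‖∫ t in T₁..T₂, θ t * (D t * mainSum P (t + u))‖
      ≤ ∫ t in T₁..T₂, ‖θ t * (D t * mainSum P (t + u))‖ := intervalIntegral.norm_integral_le_integral_norm h12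
    _ ≤ ∫ t in T₁..T₂, δ * ((‖D t‖ ^ 2 + ‖mainSum P (t + u)‖ ^ 2) / 2) := by
        refine intervalIntegral.integral_mono_on h12 ?_ ?_ fun t ht => ?_
        · exact (((hθc.mul ((hDc.mul hSc).continuousOn)).norm).mono (by rw [uIcc_of_le h12])).intervalIntegrable
        · exact ((hDi.add hSi).div_const 2).const_mul δ
        · rw [norm_mul]
          have h1 := UniversalFactor.narrow_norm_mul_le_amgm one_pos (D t) (mainSum P (t + u))
          rw [one_mul, div_one] at h1
          exact mul_le_mul (hθ t ht) h1 (norm_nonneg _) hδ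
    _ = δ * ((∫ t in T₁..T₂, ‖D t‖ ^ 2) + ∫ t in T₁..T₂, ‖mainSum P (t + u)‖ ^ 2) / 2 := by
        rw [intervalIntegral.integral_const_mul, intervalIntegral.integral_div,
          intervalIntegral.integral_add hDi hSi, mul_div_assoc]

/-! ## Term B (non-stationary) -/

/-- The cross-term integrand, expanded: `conj(E₁(t+u) E₁(t)) · conj(S_P(t+u)) · D(t)` is the double sum
`Σ_{μ,ν} μ^{-1/2} e^{iu log μ} a_ν · e^{i(t(log μ + log ν) − φ(t+u) − φ(t))}`. [folklore] -/
theorem UniversalFactor.narrowTermB_integrand_eq (P : ℕ) (a : ℕ → ℂ) (t u : ℝ) :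
    conj (thetaMainPhase (t + u) * thetaMainPhase t) * conj (mainSum P (t + u)) *
        (∑ n ∈ Finset.Icc 1 P, a n * (n : ℂ) ^ ((t : ℂ) * I)) =
      ∑ μ ∈ Finset.Icc 1 P, ∑ ν ∈ Finset.Icc 1 P,
        ((((μ : ℝ) ^ (-(1 / 2 : ℝ)) : ℝ) : ℂ) * cexp (I * u * Real.log μ) * a ν) *
          cexp (I * ((t * (Real.log μ + Real.log ν) -
            ((t + u) / 2 * Real.log ((t + u) / (2 * π)) - (t + u) / 2 - π / 8) -
            (t / 2 * Real.log (t / (2 * π)) - t / 2 - π / 8) : ℝ) : ℂ)) := by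
  rw [UniversalFactor.thetaMainPhase_shift_mul, ← Complex.exp_conj, conj_mainSum]
  simp only [Finset.mul_sum, Finset.sum_mul]
  rw [Finset.sum_comm]
  refine Finset.sum_congr rfl fun μ hμ => ?_
  refine Finset.sum_congr rfl fun ν hν => ?_
  have hν0 : 0 < ν := (Finset.mem_Icc.1 hν).1
  rw [natCast_cpow_mul_I_eq_cexp hν0]
  simp only [map_mul, Complex.conj_I, Complex.conj_ofReal]
  have : cexp (-I * (((t + u) / 2 * Real.log ((t + u) / (2 * π)) - (t + u) / 2 - π / 8 +
        (t / 2 * Real.log (t / (2 * π)) - t / 2 - π / 8) : ℝ) : ℂ)) *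
      ((((μ : ℝ) ^ (-(1 / 2 : ℝ)) : ℝ) : ℂ) * cexp (I * ((t + u : ℝ) : ℂ) * Real.log μ)) *
      (a ν * cexp (I * t * Real.log ν)) =
      ((((μ : ℝ) ^ (-(1 / 2 : ℝ)) : ℝ) : ℂ) * cexp (I * u * Real.log μ) * a ν) *
        (cexp (-I * (((t + u) / 2 * Real.log ((t + u) / (2 * π)) - (t + u) / 2 - π / 8 +
          (t / 2 * Real.log (t / (2 * π)) - t / 2 - π / 8) : ℝ) : ℂ)) *
          cexp (I * ((t + u : ℝ) : ℂ) * Real.log μ - I * u * Real.log μ) * cexp (I * t * Real.log ν)) := by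
    rw [show I * ((t + u : ℝ) : ℂ) * Real.log μ = (I * ((t + u : ℝ) : ℂ) * Real.log μ - I * u * Real.log μ) +
      I * u * Real.log μ by ring, Complex.exp_add]
    ring
  rw [this, ← Complex.exp_add, ← Complex.exp_add]
  congr 2
  push_cast
  ring

/-- **Term B bound** (van der Corput): if `T' > 0`, `U ≥ 0`, `−T'/2 ≤ u`, `2πP² ≤ T' + u` and
`a_ν = 0` unless `8πν² ≤ T'`, then
`‖∫_{T'}^{T'+U} conj(E₁(t+u)E₁(t)) conj(S_P(t+u)) D(t) dt‖ ≤ (2/log 2) (Σ_{μ≤P} μ^{-1/2}) (Σ_ν ‖a_ν‖)`.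
[cite: Titchmarsh1986, §4.17 (first-derivative test)] -/
theorem UniversalFactor.narrowTermB_le (P : ℕ) (a : ℕ → ℂ) {T' U u : ℝ} (hT' : 0 < T') (hU : 0 ≤ U)
    (hu : -(T' / 2) ≤ u) (hP : 2 * π * (P : ℝ) ^ 2 ≤ T' + u)
    (ha : ∀ ν ∈ Finset.Icc 1 P, a ν ≠ 0 → 8 * π * (ν : ℝ) ^ 2 ≤ T') :
    ‖∫ t in T'..(T' + U), conj (thetaMainPhase (t + u) * thetaMainPhase t) * conj (mainSum P (t + u)) *
        (∑ n ∈ Finset.Icc 1 P, a n * (n : ℂ) ^ ((t : ℂ) * I))‖ ≤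
      2 / Real.log 2 * (∑ μ ∈ Finset.Icc 1 P, (μ : ℝ) ^ (-(1 / 2 : ℝ))) * ∑ ν ∈ Finset.Icc 1 P, ‖a ν‖ := by
  -- name the phase and the constants
  set Φ : ℕ → ℕ → ℝ → ℝ := fun μ ν t => t * (Real.log μ + Real.log ν) -
      ((t + u) / 2 * Real.log ((t + u) / (2 * π)) - (t + u) / 2 - π / 8) -
      (t / 2 * Real.log (t / (2 * π)) - t / 2 - π / 8) with hΦ
  set c : ℕ → ℕ → ℂ := fun μ ν => (((μ : ℝ) ^ (-(1 / 2 : ℝ)) : ℝ) : ℂ) * cexp (I * u * Real.log μ) * a ν with hc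
  have hexpand : ∀ t : ℝ, conj (thetaMainPhase (t + u) * thetaMainPhase t) * conj (mainSum P (t + u)) *
      (∑ n ∈ Finset.Icc 1 P, a n * (n : ℂ) ^ ((t : ℂ) * I)) =
      ∑ μ ∈ Finset.Icc 1 P, ∑ ν ∈ Finset.Icc 1 P, c μ ν * cexp (I * (Φ μ ν t : ℂ)) := fun t =>
    UniversalFactor.narrowTermB_integrand_eq P a t u
  simp_rw [hexpand]
  -- continuity of each oscillatory factor on the block (for interchanging sum and integral)
  have hpos_t : ∀ t ∈ uIcc T' (T' + U), 0 < t := fun t ht => by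
    rw [uIcc_of_le (by linarith)] at ht; linarith [ht.1]
  have hpos_tu : ∀ t ∈ uIcc T' (T' + U), 0 < t + u := fun t ht => by
    rw [uIcc_of_le (by linarith)] at ht; linarith [ht.1]
  have hΦc : ∀ μ ν, ContinuousOn (fun t => cexp (I * (Φ μ ν t : ℂ))) (uIcc T' (T' + U)) := by
    intro μ ν
    refine (Complex.continuous_exp.comp_continuousOn ((continuous_const.mul Complex.continuous_ofReal).comp_continuousOn ?_))
    simp only [hΦ]
    refine ((continuousOn_id.mul continuousOn_const).sub ?_).sub ?_
    · refine ((ContinuousOn.mul ((continuousOn_id.add continuousOn_const).div_const 2) ?_).sub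
        ((continuousOn_id.add continuousOn_const).div_const 2)).sub continuousOn_const
      exact Real.continuousOn_log.comp ((continuousOn_id.add continuousOn_const).div_const _)
        fun t ht => div_ne_zero (ne_of_gt (hpos_tu t ht)) (by positivity)
    · refine ((ContinuousOn.mul (continuousOn_id.div_const 2) ?_).sub (continuousOn_id.div_const 2)).sub
        continuousOn_const
      exact Real.continuousOn_log.comp (continuousOn_id.div_const _)
        fun t ht => div_ne_zero (ne_of_gt (hpos_t t ht)) (by positivity)
  have hint : ∀ μ ν, IntervalIntegrable (fun t => c μ ν * cexp (I * (Φ μ ν t : ℂ))) volume T' (T' + U) :=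
    fun μ ν => (continuousOn_const.mul (hΦc μ ν)).intervalIntegrable
  have hint' : ∀ μ, IntervalIntegrable (fun t => ∑ ν ∈ Finset.Icc 1 P, c μ ν * cexp (I * (Φ μ ν t : ℂ)))
      volume T' (T' + U) :=
    fun μ => (continuousOn_finsetSum _ fun ν _ => continuousOn_const.mul (hΦc μ ν)).intervalIntegrable
  rw [intervalIntegral.integral_finsetSum fun μ _ => hint' μ]
  simp_rw [intervalIntegral.integral_finsetSum fun ν _ => hint _ ν]
  -- bound term by term
  have hterm : ∀ μ ∈ Finset.Icc 1 P, ∀ ν ∈ Finset.Icc 1 P,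
      ‖∫ t in T'..(T' + U), c μ ν * cexp (I * (Φ μ ν t : ℂ))‖ ≤
        (μ : ℝ) ^ (-(1 / 2 : ℝ)) * ‖a ν‖ * (2 / Real.log 2) := by
    intro μ hμ ν hν
    have hμ1 : 1 ≤ μ := (Finset.mem_Icc.1 hμ).1
    have hν1 : 1 ≤ ν := (Finset.mem_Icc.1 hν).1
    have hμR : (0 : ℝ) < μ := by exact_mod_cast hμ1
    have hcnorm : ‖c μ ν‖ = (μ : ℝ) ^ (-(1 / 2 : ℝ)) * ‖a ν‖ := by
      simp only [hc, norm_mul, Complex.norm_real, Real.norm_eq_abs, abs_of_nonneg (Real.rpow_nonneg hμR.le _)]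
      rw [show I * (u : ℂ) * (Real.log μ : ℂ) = ((u * Real.log μ : ℝ) : ℂ) * I by push_cast; ring,
        Complex.norm_exp_ofReal_mul_I, mul_one]
    by_cases haν : a ν = 0
    · simp [hc, haν]
    have h8 : 8 * π * (ν : ℝ) ^ 2 ≤ T' := ha ν hν haν
    have hμP : 2 * π * (μ : ℝ) ^ 2 ≤ T' + u := by
      have hμle : (μ : ℝ) ≤ P := by exact_mod_cast (Finset.mem_Icc.1 hμ).2
      have : (μ : ℝ) ^ 2 ≤ (P : ℝ) ^ 2 := pow_le_pow_left₀ hμR.le hμle 2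
      nlinarith [Real.pi_pos]
    rw [intervalIntegral.integral_const_mul, norm_mul, hcnorm]
    have hv := UniversalFactor.norm_integral_termB_phase_le (μ := μ) (ν := ν) hT' hU hu hμ1 hν1 hμP h8
    exact mul_le_mul_of_nonneg_left hv (by positivity)
  calc ‖∑ μ ∈ Finset.Icc 1 P, ∑ ν ∈ Finset.Icc 1 P, ∫ t in T'..(T' + U), c μ ν * cexp (I * (Φ μ ν t : ℂ))‖
      ≤ ∑ μ ∈ Finset.Icc 1 P, ∑ ν ∈ Finset.Icc 1 P, (μ : ℝ) ^ (-(1 / 2 : ℝ)) * ‖a ν‖ * (2 / Real.log 2) := by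
        refine (norm_sum_le _ _).trans (Finset.sum_le_sum fun μ hμ => ?_)
        exact (norm_sum_le _ _).trans (Finset.sum_le_sum fun ν hν => hterm μ hμ ν hν)
    _ = 2 / Real.log 2 * ((∑ μ ∈ Finset.Icc 1 P, (μ : ℝ) ^ (-(1 / 2 : ℝ))) * ∑ ν ∈ Finset.Icc 1 P, ‖a ν‖) := by
        rw [Finset.sum_mul, Finset.mul_sum]
        refine Finset.sum_congr rfl fun μ _ => ?_
        rw [Finset.mul_sum, Finset.mul_sum]
        refine Finset.sum_congr rfl fun ν _ => ?_
        ring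
    _ = 2 / Real.log 2 * (∑ μ ∈ Finset.Icc 1 P, (μ : ℝ) ^ (-(1 / 2 : ℝ))) * ∑ ν ∈ Finset.Icc 1 P, ‖a ν‖ := by
        ring

/-- Registered sub-stub `narrowTerms_hardyZ_linear` of crux `stmt-RiemannHypothesis-2576` (binder-free restatement of
`UniversalFactor.norm_hardyZ_le_linear`, used by the gate to attach this helper file to the crux). [folklore] -/
theorem UniversalFactor.narrowTerms_hardyZ_linear : ∀ τ : ℝ, ‖(hardyZ τ : ℂ)‖ ≤ 2 + 2 * |τ| :=
  fun τ => UniversalFactor.norm_hardyZ_le_linear τ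

end Summit.RiemannHypothesis.RiemannHypothesis.Theorems
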